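import Summits.Langlands.Langlands.Theorems.IrreducibilityBySelfDualityPairLBoundaryJS
import Summits.Langlands.Langlands.Theorems.IrreducibilityBySelfDualityPairLBoundaryJSSsv
import Summits.Langlands.Langlands.Theorems.IrreducibilityBySelfDualityPairLBoundaryJSStandardEntire
import Summits.Langlands.Langlands.Theorems.IrreducibilityBySelfDualityPairLBoundaryJSIsOrthoOfLocalTranslate
import Summits.Langlands.Langlands.Theorems.IrreducibilityBySelfDualityPairLBoundaryJSEqConjOfLocalTranslate
import Summits.Langlands.Langlands.Theorems.IrreducibilityBySelfDualityPairLBoundaryJSLocalPairTranslate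
import Summits.Langlands.Langlands.Theorems.IrreducibilityBySelfDualityPairLBoundaryJSOfHumphriesJo
import Summits.Langlands.Langlands.Theorems.IrreducibilityBySelfDualityPairLBoundaryJSCornerAbsMajorant
import Summits.Langlands.Langlands.Theorems.IrreducibilityBySelfDualityPairLBoundaryJSCornerAbsIdeleMoment
import Summits.Langlands.Langlands.Theorems.IrreducibilityBySelfDualityPairLBoundaryJSCornerAbsTorusMajorant
import Summits.Langlands.Langlands.Theorems.IrreducibilityBySelfDualityPairLBoundaryJSGapAbsMajorant
import Literature.NumberTheory.Automorphic.PairLFunctionMeromorphicContinuationRankNeTwistProofs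
import Literature.NumberTheory.Automorphic.ArchRankinSelbergTestVector
import Literature.NumberTheory.Automorphic.JPSSGlobalIntegralQuotientUnfolding
import Literature.NumberTheory.Automorphic.JPSSCornerWhittakerUnfolding
import Literature.NumberTheory.Automorphic.WhittakerPeriodExchange
import Literature.NumberTheory.Automorphic.TorusIwasawaTransport
import Literature.NumberTheory.Automorphic.CornerTorusIwasawaData
import Literature.NumberTheory.Automorphic.WhittakerCoeffHonestCuspForm
import Literature.NumberTheory.Automorphic.WhittakerCoeffTranslateUnramified
import Literature.NumberTheory.Automorphic.WhittakerDecayCuspForm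
import Literature.NumberTheory.Automorphic.WhittakerSupportFinite
import Literature.NumberTheory.Automorphic.RankinSelbergUnramifiedTorus
import Literature.NumberTheory.Automorphic.RankinSelbergTorusPairEuler
import Literature.NumberTheory.Automorphic.RankinSelbergTowerFiniteness

/-!
# Absolute convergence of the unfolded `GL_n × GL_m` integral (one-factor form)

Summit `Langlands`, sub-problem `Langlands`, helper file under `Theorems/` supporting the crux
`PairLBoundaryJS` (stmt-Langlands-13622), line `Sketch`, registered stub `stub_gap_abs_convergence` (G-Ac),
part 2 of 2 (part 1: `…GapAbsMajorant`, the Iwasawa data, the finite support and the single-coordinate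
archimedean decay at the `GL_n` corner torus points). The absolute convergence of the unfolded `GL_n × GL_m`
Rankin–Selberg integral (`0 < m < n`, `ι = glCorner (m ≤ n) : h ↦ diag(h, 1_{n-m})`) for `Re s ≫ 0`
(Cogdell (2004), §2.2–2.3 "absolutely convergent for `Re s ≫ 0` by the gauge estimates";
Jacquet–Piatetski-Shapiro–Shalika (1983), §2) in its ONE-factor form

  `∫_{(𝔸_Kˣ)ᵐ × K_m} |W_φ(ι(diag(a) k))| |det a|^σ δ_B(a)⁻¹ d(νA × νK) < ∞`  (`σ ≥ σ₀ = m + 1`),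

`W_φ = whittakerDepth 0 φ`, for an `A_G`-invariant honest cusp form `φ` on `GL_n(𝔸_K)` — the `GL_n` version of
`…CornerAbsConvergence` (the case `n = m + 1`):

* `norm_whittakerDepth_glCorner_mul_prod_pow_le`, `gap_majorant` — the product archimedean decay and the
  assembled **pointwise majorant** `‖W_φ(ι(diag(a) k))‖ ≤ C ∏_{l,w} min(1, ‖a_{l,w}‖^{-M})` for every `M`,
  supported in `{|a_{l,v}|_v ≤ R_v}` with `R_v ≥ 1`, `R_v = 1` off a finite set (from part 1, a principal
  congruence level, Tate's bound `exists_finset_bound_adeleAddCharAt` and the bounded smooth derivatives of an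
  `A_G`-invariant honest cusp form);
* `enorm_mul_ofReal_le_of_majorant`, `lintegral_gap_lt_top` — pointwise domination of the integrand by `C`
  times the torus majorant, whose torus integral is finite for `σ ≥ m + 1`
  (`CornerAbsTorusMajorant.lintegral_majorant_lt_top`, the torus side being that of the corner case verbatim),
  `lintegral_prod_le` and `νK(K_m) < ∞`;
* `stub_gap_abs_convergence` — the registered `∀`-closed statement.

## References

* J. W. Cogdell, *Analytic theory of L-functions for GL_n*, in *An Introduction to the Langlands
  Program* (2004), §2.2–2.3 [CogdellAnalyticTheory2004].
* H. Jacquet, I. I. Piatetski-Shapiro, J. Shalika, *Rankin–Selberg convolutions*, Amer. J. Math. 105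
  (1983), §2 [JPSS1983].
-/

noncomputable section

-- `Summit.Langlands.Langlands.…` (summit = sub-problem name, D-0017 layout) trips `dupNamespace`
set_option linter.dupNamespace false

open scoped MatrixGroups Topology Pointwise ENNReal NNReal ComplexConjugate InnerProductSpace ContDiff
-- the place subtypes indexing `mixedSpace K` are `Fintype` classically (`NormedCommRing (mixedSpace K)`)
open scoped Classical Matrix.Norms.Operator
open NumberField IsDedekindDomain MeasureTheory Measure Matrix Set Filter WithZero
open NumberField.mixedEmbedding
open Literature.NumberTheory.Automorphic AdelicGroupData
open Literature.NumberTheory.GaloisRepresentations (ideleGroup HeckeCharacter)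
open Literature.MeasureTheory.Group
open Literature.RingTheory.SymmetricFunctions.SymmPoly
open ValuativeRel

-- the automorphic quotient carries the tree's Borel σ-algebra, not Mathlib's quotient σ-algebra
attribute [-instance] Quotient.instMeasurableSpace QuotientGroup.measurableSpace

-- the house local instances, exactly as in `RankinSelbergUnfoldingIdentity`
attribute [local instance] adelicBorel borelSpace_adelic locallyCompactSpace_adelic secondCountableTopology_gl_adelic
  glAdeleBorel borelSpace_glAdele borelSpace_ideleGroup secondCountableTopology_ideleGroup

-- Mathlib idiom: the commutator Lie ring on matrices, to mention `(archGroupGL n K).lie`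
attribute [local instance 100] LieRing.ofAssociativeRing


namespace Summit.Langlands.Langlands.Theorems.GapAbsConvergence

section Main

variable {n m : ℕ} {K : Type} [Field K] [NumberField K]

/-! ### The product majorant at the `GL_n` corner torus points -/

/-- **Product archimedean decay at the `GL_n` corner torus points**: for `0 < m < n` and every `M` there is
`C ≥ 0` with `‖W_φ(ι(diag(a) k))‖ · (∏_{l,w} max(1, ‖a_{l,w}‖))^M ≤ C` (the single-coordinate decay with exponent
`N M`, `N = m · #{w}`, in the coordinate of largest archimedean size, and the trivial bound `‖W_φ‖ ≤ sup ‖φ‖` when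
all sizes are `≤ 1`). [cite: CogdellAnalyticTheory2004, Thm. 1.1 and §2.3] -/
theorem norm_whittakerDepth_glCorner_mul_prod_pow_le (hm : 0 < m) (hmn : m < n)
    {φ : GL (Fin n) (AdeleRing (𝓞 K) K) → ℂ}
    (hφK : ∀ (γ₀ : GL (Fin n) K) (x : GL (Fin n) (AdeleRing (𝓞 K) K)),
      φ (Matrix.GeneralLinearGroup.map (algebraMap K (AdeleRing (𝓞 K) K)) γ₀ * x) = φ x)
    (hs : ∀ l : List (archGroupGL n K).lie, IsArchSmooth (glArch n K) (iterLieDeriv (glArch n K) l φ))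
    (hc : ∀ l : List (archGroupGL n K).lie, Continuous (iterLieDeriv (glArch n K) l φ))
    (hb : ∀ l : List (archGroupGL n K).lie, ∃ C : ℝ, ∀ z, ‖iterLieDeriv (glArch n K) l φ z‖ ≤ C)
    (M : ℕ) :
    ∃ C : ℝ, 0 ≤ C ∧ ∀ (a : Fin m → ideleGroup K) (k : ↥(maximalCompactAdelic m K)),
      ‖whittakerDepth 0 φ (glCorner (AdeleRing (𝓞 K) K) hmn.le (torusPoint m K (a, k)))‖ *
        (∏ l : Fin m, ∏ w : InfinitePlace K, max 1 ‖((a l : ideleGroup K) : AdeleRing (𝓞 K) K).1 w‖) ^ M ≤ C := by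
  set N : ℕ := m * Fintype.card (InfinitePlace K) with hN
  choose Cd hCd0 hCd using fun (w : InfinitePlace K) (l : Fin m) =>
    GapAbsMajorant.norm_whittakerDepth_glCorner_mul_pow_le hmn hφK hs hc hb w (N * M) l
  obtain ⟨B, hB⟩ := hb []
  set C₁ : ℝ := ∑ w, ∑ l, Cd w l with hC₁
  have hC₁0 : 0 ≤ C₁ := Finset.sum_nonneg fun w _ => Finset.sum_nonneg fun l _ => hCd0 w l
  have hCdle : ∀ w l, Cd w l ≤ C₁ := fun w l =>
    (Finset.single_le_sum (f := fun l' => Cd w l') (fun l' _ => hCd0 w l') (Finset.mem_univ l)).trans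
      (Finset.single_le_sum (f := fun w' => ∑ l', Cd w' l') (fun w' _ => Finset.sum_nonneg fun l' _ => hCd0 w' l')
        (Finset.mem_univ w))
  refine ⟨max B 0 + C₁, by positivity, fun a k => ?_⟩
  haveI : Nonempty (Fin m) := ⟨⟨0, hm⟩⟩
  set f : Fin m × InfinitePlace K → ℝ := fun p => ‖((a p.1 : ideleGroup K) : AdeleRing (𝓞 K) K).1 p.2‖ with hf
  obtain ⟨p, -, hp⟩ := Finset.exists_max_image Finset.univ f Finset.univ_nonempty
  set W : ℝ := ‖whittakerDepth 0 φ (glCorner (AdeleRing (𝓞 K) K) hmn.le (torusPoint m K (a, k)))‖ with hWdef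
  have hW0 : 0 ≤ W := norm_nonneg _
  have hWB : W ≤ max B 0 := (norm_whittakerDepth_le (fun z => hB z) 0 _).trans (le_max_left _ _)
  have hprod0 : 0 ≤ ∏ l : Fin m, ∏ w : InfinitePlace K, max 1 ‖((a l : ideleGroup K) : AdeleRing (𝓞 K) K).1 w‖ :=
    Finset.prod_nonneg fun l _ => Finset.prod_nonneg fun w _ => le_trans zero_le_one (le_max_left _ _)
  have hprod : (∏ l : Fin m, ∏ w : InfinitePlace K, max 1 ‖((a l : ideleGroup K) : AdeleRing (𝓞 K) K).1 w‖) ≤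
      (max 1 (f p)) ^ N := by
    calc (∏ l : Fin m, ∏ w : InfinitePlace K, max 1 ‖((a l : ideleGroup K) : AdeleRing (𝓞 K) K).1 w‖)
        ≤ ∏ _l : Fin m, ∏ _w : InfinitePlace K, max 1 (f p) :=
          Finset.prod_le_prod (fun l _ => Finset.prod_nonneg fun w _ => le_trans zero_le_one (le_max_left _ _))
            fun l _ => Finset.prod_le_prod (fun w _ => le_trans zero_le_one (le_max_left _ _))
              fun w _ => max_le_max le_rfl (hp (l, w) (Finset.mem_univ _))
      _ = (max 1 (f p)) ^ N := by
          rw [Finset.prod_const, Finset.prod_const, Finset.card_univ, Finset.card_univ, Fintype.card_fin, ← pow_mul,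
            hN, mul_comm]
  have h1 : W * (∏ l : Fin m, ∏ w : InfinitePlace K, max 1 ‖((a l : ideleGroup K) : AdeleRing (𝓞 K) K).1 w‖) ^ M ≤
      W * (max 1 (f p)) ^ (N * M) := by
    rw [pow_mul]
    exact mul_le_mul_of_nonneg_left (pow_le_pow_left₀ hprod0 hprod M) hW0
  refine h1.trans ?_
  rcases le_or_gt (f p) 1 with hρ | hρ
  · rw [max_eq_left hρ, one_pow, mul_one]
    exact hWB.trans (le_add_of_nonneg_right hC₁0)
  · rw [max_eq_right hρ.le]
    exact (hCd p.2 p.1 a k).trans ((hCdle p.2 p.1).trans (le_add_of_nonneg_left (le_max_right _ _)))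

/-! ### The majorant for an `A_G`-invariant honest cusp form on `GL_n` -/

/-- **The `GL_n` corner majorant of an `A_G`-invariant honest cusp form on `GL_n(𝔸_K)`** (`0 < m < n`). There
are a finite set `S` of finite places and bounds `R_v ∈ ℤₘ₀`, `R_v ≥ 1`, `R_v = 1` off `S`, such that
(i) **finite support**: `W_φ(ι(diag(a) k)) ≠ 0` forces `|a_{l,v}|_v ≤ R_v` for all `l < m` and all finite `v`;
(ii) **archimedean decay**: for every `M` there is `C ≥ 0` with
`‖W_φ(ι(diag(a) k))‖ ≤ C ∏_{l<m} ∏_{w|∞} min(1, ‖a_{l,w}‖^{-M})` for all `a ∈ (𝔸_Kˣ)ᵐ`, `k ∈ K_m` — the gauge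
estimates of the unfolded `GL_n × GL_m` integral (left `GL_n(K)`-invariance, a principal congruence level
`IsCuspFormGL.exists_principalCongruenceLevel`, Tate's bound `exists_finset_bound_adeleAddCharAt`, bounded smooth
derivatives `IsCuspFormGL.isArchSmooth_continuous_bounded_iterLieDeriv_of_center'`).
[cite: CogdellAnalyticTheory2004, §2.2–2.3] -/
theorem gap_majorant (hm : 0 < m) (hmn : m < n) {φ : GL (Fin n) (AdeleRing (𝓞 K) K) → ℂ}
    (hφ : IsCuspFormGL n K (isCompact_glFiniteIntegralLevel_holds n K) φ)
    (hA : ∀ z ∈ (AdelicGroupData.gl n K).center', ∀ g : (AdelicGroupData.gl n K).Adelic, φ (z * g) = φ g) :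
    ∃ (S : Finset (HeightOneSpectrum (𝓞 K))) (R : HeightOneSpectrum (𝓞 K) → WithZero (Multiplicative ℤ)),
      (∀ v, 1 ≤ R v) ∧ (∀ v ∉ S, R v = 1) ∧
      (∀ (a : Fin m → ideleGroup K) (k : ↥(maximalCompactAdelic m K)),
        whittakerDepth 0 φ (glCorner (AdeleRing (𝓞 K) K) hmn.le (torusPoint m K (a, k))) ≠ 0 →
        ∀ (l : Fin m) (v : HeightOneSpectrum (𝓞 K)), Valued.v (((a l : ideleGroup K) : AdeleRing (𝓞 K) K).2 v) ≤ R v) ∧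
      ∀ M : ℕ, ∃ C : ℝ, 0 ≤ C ∧ ∀ (a : Fin m → ideleGroup K) (k : ↥(maximalCompactAdelic m K)),
        ‖whittakerDepth 0 φ (glCorner (AdeleRing (𝓞 K) K) hmn.le (torusPoint m K (a, k)))‖ ≤
          C * ∏ l : Fin m, ∏ w : InfinitePlace K, ((max 1 ‖((a l : ideleGroup K) : AdeleRing (𝓞 K) K).1 w‖) ^ M)⁻¹ := by
  have hφK : ∀ (γ₀ : GL (Fin n) K) (x : GL (Fin n) (AdeleRing (𝓞 K) K)),
      φ (Matrix.GeneralLinearGroup.map (algebraMap K (AdeleRing (𝓞 K) K)) γ₀ * x) = φ x :=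
    fun γ₀ x => hφ.1.leftInvariant _ (show _ ∈ rationalPointsGL n K from ⟨γ₀, rfl⟩) x
  obtain ⟨𝔫, h𝔫, hU⟩ := hφ.exists_principalCongruenceLevel
  have hφU : ∀ x, ∀ u ∈ principalCongruenceLevel n K 𝔫, φ (x * u) = φ x := fun x u hu => hU u hu x
  obtain ⟨S, B, hB1, hBS, hB⟩ := exists_finset_bound_adeleAddCharAt K h𝔫
  have hpack := fun l => hφ.isArchSmooth_continuous_bounded_iterLieDeriv_of_center' hA l
  refine ⟨S, fun v => B v ^ m, fun v => one_le_pow_of_one_le' (hB1 v) m, fun v hv => by show B v ^ m = 1; rw [hBS v hv, one_pow],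
    fun a k hW l v => ?_, fun M => ?_⟩
  · exact (GapAbsMajorant.valued_le_pow_of_whittakerDepth_glCorner_ne_zero hmn hφK hφU hB hW v l).trans
      (pow_le_pow_right' (hB1 v) (Nat.sub_le m l))
  · obtain ⟨C, hC0, hC⟩ := norm_whittakerDepth_glCorner_mul_prod_pow_le hm hmn hφK (fun l => (hpack l).2.2.1)
      (fun l => (hpack l).2.2.2.1) (fun l => (hpack l).2.2.2.2) M
    refine ⟨C, hC0, fun a k => ?_⟩
    have hpos : 0 < (∏ l : Fin m, ∏ w : InfinitePlace K, max 1 ‖((a l : ideleGroup K) : AdeleRing (𝓞 K) K).1 w‖) ^ M :=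
      pow_pos (Finset.prod_pos fun l _ => Finset.prod_pos fun w _ => lt_of_lt_of_le one_pos (le_max_left _ _)) M
    have h := hC a k
    rw [← le_div_iff₀ hpos] at h
    refine h.trans (le_of_eq ?_)
    rw [div_eq_mul_inv, ← Finset.prod_pow, ← Finset.prod_inv_distrib]
    congr 1
    refine Finset.prod_congr rfl fun l _ => ?_
    rw [← Finset.prod_pow, ← Finset.prod_inv_distrib]

/-! ### Domination and the lintegral bound -/

/-- **Pointwise domination of the `GL_n × GL_m` integrand by the torus majorant.** If `W` on `GL_n(𝔸_K)` is
supported in `{|a_{l,v}|_v ≤ R_v ∀ l, v}` at the corner torus points `ι(diag(a) k)` and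
`‖W(ι(diag(a) k))‖ ≤ C · D(a)` with `C ≥ 0`, then
`‖W(ι(diag(a) k))‖ₑ · w(a) ≤ C · (𝟙{|a_{l,v}|_v ≤ R_v} · D(a) · w(a))` in `ℝ≥0∞` for every weight `w`
(case split on `W = 0`). [folklore] -/
theorem enorm_mul_ofReal_le_of_majorant (hmn : m ≤ n) {W : GL (Fin n) (AdeleRing (𝓞 K) K) → ℂ}
    {R : HeightOneSpectrum (𝓞 K) → WithZero (Multiplicative ℤ)}
    (hsupp : ∀ (a : Fin m → ideleGroup K) (k : ↥(maximalCompactAdelic m K)),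
      W (glCorner (AdeleRing (𝓞 K) K) hmn (torusPoint m K (a, k))) ≠ 0 →
      ∀ (l : Fin m) (v : HeightOneSpectrum (𝓞 K)), Valued.v (((a l : ideleGroup K) : AdeleRing (𝓞 K) K).2 v) ≤ R v)
    {C : ℝ} (hC0 : 0 ≤ C) {D : (Fin m → ideleGroup K) → ℝ}
    (hC : ∀ (a : Fin m → ideleGroup K) (k : ↥(maximalCompactAdelic m K)),
      ‖W (glCorner (AdeleRing (𝓞 K) K) hmn (torusPoint m K (a, k)))‖ ≤ C * D a)
    (w : (Fin m → ideleGroup K) → ℝ) (a : Fin m → ideleGroup K) (k : ↥(maximalCompactAdelic m K)) :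
    ‖W (glCorner (AdeleRing (𝓞 K) K) hmn (torusPoint m K (a, k)))‖ₑ * ENNReal.ofReal (w a) ≤
      ENNReal.ofReal C *
        ((if ∀ (l : Fin m) (v : HeightOneSpectrum (𝓞 K)),
            Valued.v (((a l : ideleGroup K) : AdeleRing (𝓞 K) K).2 v) ≤ R v then 1 else 0) *
          ENNReal.ofReal (D a) * ENNReal.ofReal (w a)) := by
  by_cases hW : W (glCorner (AdeleRing (𝓞 K) K) hmn (torusPoint m K (a, k))) = 0
  · rw [hW, enorm_zero, zero_mul]
    exact zero_le
  · rw [if_pos (hsupp a k hW), one_mul, ← ofReal_norm, ← mul_assoc, ← ENNReal.ofReal_mul hC0]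
    exact mul_le_mul' (ENNReal.ofReal_le_ofReal (hC a k)) le_rfl

variable [MeasurableSpace (AdeleRing (𝓞 K) K)] [BorelSpace (AdeleRing (𝓞 K) K)]

/-- **Absolute convergence of the unfolded `GL_n × GL_m` integral (one-factor form)** (Cogdell (2004),
§2.2–2.3; JPSS (1983), §2). Let `φ` be an `A_G`-invariant honest cusp form on `GL_n(𝔸_K)` (`0 < m < n`) and
`νA`, `νK` Haar measures on `(𝔸_Kˣ)ᵐ` and `K_m`. Then for `σ ≥ m + 1`,
`∫ |W_φ(ι(diag(a) k))| |det a|^σ δ_B(a)⁻¹ d(νA × νK) < ∞`: by the majorant `gap_majorant` (with `E = ⌈σ⌉₊ + m`,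
`M = [K:ℚ] E + dim_ℝ K_∞ + 1`) the integrand is pointwise `≤ C` times the torus majorant
`𝟙{|a_{l,v}|_v ≤ R_v} ∏_{l,w} min(1, ‖a_{l,w}‖^{-M}) |det a|^σ δ_B(a)⁻¹`, whose `νA`-integral is finite
(`CornerAbsTorusMajorant.lintegral_majorant_lt_top` — the torus side of the `GL_{m+1} × GL_m` case, unchanged),
and `νK(K_m) < ∞` (`K_m` is compact). [cite: CogdellAnalyticTheory2004, §2.2–2.3] -/
theorem lintegral_gap_lt_top (hm : 0 < m) (hmn : m < n)
    (νA : Measure (Fin m → ideleGroup K)) [IsHaarMeasure νA]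
    (νK : Measure ↥(maximalCompactAdelic m K)) [IsHaarMeasure νK]
    {φ : GL (Fin n) (AdeleRing (𝓞 K) K) → ℂ}
    (hφ : IsCuspFormGL n K (isCompact_glFiniteIntegralLevel_holds n K) φ)
    (hA : ∀ z ∈ (AdelicGroupData.gl n K).center', ∀ g : (AdelicGroupData.gl n K).Adelic, φ (z * g) = φ g)
    {σ : ℝ} (hσ : (m : ℝ) + 1 ≤ σ) :
    ∫⁻ p, ‖whittakerDepth 0 φ (glCorner (AdeleRing (𝓞 K) K) hmn.le (torusPoint m K p))‖ₑ *
        ENNReal.ofReal (torusWeight m K σ p.1) ∂(νA.prod νK) < ⊤ := by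
  -- `K_m` is compact, so the Haar measure `νK` is finite
  haveI : CompactSpace ↥(maximalCompactAdelic m K) :=
    isCompact_iff_compactSpace.1 (isCompact_maximalCompactAdelic m K)
  have hK : νK Set.univ < ⊤ := measure_lt_top νK _
  -- the `GL_n` corner majorant of `W_φ`
  obtain ⟨S, R, hR, hRS, hsupp, hdec⟩ := gap_majorant hm hmn hφ hA
  -- exponents `E ≥ σ + m`, `M = [K:ℚ] E + dim K_∞ + 1`
  have hE : σ + m ≤ ((⌈σ⌉₊ + m : ℕ) : ℝ) := by
    rw [Nat.cast_add]
    exact add_le_add (Nat.le_ceil σ) le_rfl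
  obtain ⟨C, hC0, hC⟩ := hdec (Module.finrank ℚ K * (⌈σ⌉₊ + m) + Module.finrank ℝ (mixedSpace K) + 1)
  -- the torus majorant and its finiteness (the torus side of the corner case)
  set G : (Fin m → ideleGroup K) → ℝ≥0∞ := fun a =>
    (if ∀ (l : Fin m) (v : HeightOneSpectrum (𝓞 K)),
        Valued.v (((a l : ideleGroup K) : AdeleRing (𝓞 K) K).2 v) ≤ R v then 1 else 0) *
      ENNReal.ofReal (∏ l : Fin m, ∏ w : InfinitePlace K,
        ((max 1 ‖((a l : ideleGroup K) : AdeleRing (𝓞 K) K).1 w‖) ^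
          (Module.finrank ℚ K * (⌈σ⌉₊ + m) + Module.finrank ℝ (mixedSpace K) + 1))⁻¹) *
      ENNReal.ofReal (torusWeight m K σ a) with hG_def
  have hfin : ∫⁻ a, G a ∂νA < ⊤ := CornerAbsTorusMajorant.lintegral_majorant_lt_top νA S hR hRS hσ hE le_rfl
  -- pointwise domination
  have hpt : ∀ p : (Fin m → ideleGroup K) × ↥(maximalCompactAdelic m K),
      ‖whittakerDepth 0 φ (glCorner (AdeleRing (𝓞 K) K) hmn.le (torusPoint m K p))‖ₑ *
          ENNReal.ofReal (torusWeight m K σ p.1) ≤ ENNReal.ofReal C * G p.1 := fun p =>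
    enorm_mul_ofReal_le_of_majorant hmn.le hsupp hC0 hC (torusWeight m K σ) p.1 p.2
  have hCK : ENNReal.ofReal C * νK Set.univ < ⊤ := ENNReal.mul_lt_top ENNReal.ofReal_lt_top hK
  calc ∫⁻ p, ‖whittakerDepth 0 φ (glCorner (AdeleRing (𝓞 K) K) hmn.le (torusPoint m K p))‖ₑ *
          ENNReal.ofReal (torusWeight m K σ p.1) ∂(νA.prod νK)
      ≤ ∫⁻ p, ENNReal.ofReal C * G p.1 ∂(νA.prod νK) := lintegral_mono hpt
    _ ≤ ∫⁻ a, ∫⁻ _k, ENNReal.ofReal C * G a ∂νK ∂νA :=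
        lintegral_prod_le (fun p : (Fin m → ideleGroup K) × ↥(maximalCompactAdelic m K) => ENNReal.ofReal C * G p.1)
    _ = ∫⁻ a, ENNReal.ofReal C * νK Set.univ * G a ∂νA := by
        refine lintegral_congr fun a => ?_
        rw [lintegral_const, mul_right_comm]
    _ = ENNReal.ofReal C * νK Set.univ * ∫⁻ a, G a ∂νA := lintegral_const_mul' _ _ hCK.ne
    _ < ⊤ := ENNReal.mul_lt_top hCK hfin

end Main

/-! ### The registered stub -/

/-- **STUB (G-Ac) — one-factor absolute convergence of the unfolded `GL_n × GL_m` integral** (Cogdell (2004),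
§2.2 "absolutely convergent for `Re s ≫ 0` by the gauge estimates"; JPSS (1983), §2): for an `A_G`-invariant
honest cusp form `φ` on `GL_n(𝔸_K)` (`0 < m < n`) there is `σ₀` (`= m + 1`) with
`∫_{(𝔸ˣ)ᵐ × K_m} |W_φ(diag(diag(a)k, 1_{n-m}))| |det a|^σ δ_B(a)⁻¹ d(νA × νK) < ∞` for all `σ ≥ σ₀`
(`W_φ = whittakerDepth 0 φ`) — the `∀`-closed form of `lintegral_gap_lt_top`: the `GL_n` Whittaker majorant at the
corner torus points (`gap_majorant`), the torus integral of the majorant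
(`CornerAbsTorusMajorant.lintegral_majorant_lt_top`) and `νK(K_m) < ∞`.
[cite: CogdellAnalyticTheory2004, §2.2–2.3] -/
theorem stub_gap_abs_convergence :
    ∀ {n m : ℕ} {K : Type} [Field K] [NumberField K]
      [MeasurableSpace (AdeleRing (𝓞 K) K)] [BorelSpace (AdeleRing (𝓞 K) K)] (_hm : 0 < m) (hmn : m < n)
      (νA : Measure (Fin m → ideleGroup K)) [IsHaarMeasure νA]
      (νK : Measure ↥(maximalCompactAdelic m K)) [IsHaarMeasure νK]
      {φ : GL (Fin n) (AdeleRing (𝓞 K) K) → ℂ},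
      IsCuspFormGL n K (isCompact_glFiniteIntegralLevel_holds n K) φ →
      (∀ z ∈ (AdelicGroupData.gl n K).center', ∀ g : (AdelicGroupData.gl n K).Adelic, φ (z * g) = φ g) →
      ∃ σ₀ : ℝ, ∀ σ : ℝ, σ₀ ≤ σ →
        ∫⁻ p, ‖whittakerDepth 0 φ (glCorner (AdeleRing (𝓞 K) K) hmn.le (torusPoint m K p))‖ₑ *
            ENNReal.ofReal (torusWeight m K σ p.1) ∂(νA.prod νK) < ⊤ := by
  intro n m K _ _ _ _ _hm hmn νA _ νK _ φ hφ hA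
  exact ⟨(m : ℝ) + 1, fun σ hσ => lintegral_gap_lt_top _hm hmn νA νK hφ hA hσ⟩

end Summit.Langlands.Langlands.Theorems.GapAbsConvergence

end
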